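import Literature.Probability.Process.StableLikeJumpChainTruncate
import Literature.Probability.Process.StableLikeJumpChainDiag
import HarnessLib

/-!
# Near-diagonal lower bound for stable-like chains on `ℤ^d` (Bass–Levin Prop. 5.1) — PHI-free

Support file for the proof of Bass–Levin 2002, Theorem 1.1
(`Literature.Probability.Process.bassLevin_thm_1_1`). For a Markov kernel `P` on `ℤ^d`,
reversible with respect to weights `m ≤ μ ≤ M`, with two-sided stable-like bounds
`c₁ ‖x−y‖^{-(d+α)} ≤ P x y ≤ c₂ ‖x−y‖^{-(d+α)}`, and its powers `Q`, we prove: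

* `kpow_far_le_of_offdiag` : the off-diagonal upper bound `Q n x y ≤ C_O n ‖x−y‖^{-(d+α)}`
  (`‖x−y‖ ≥ n^{1/α}`) gives the tail bound `∑_{‖z−x‖>r} Q k x z ≤ C_T k r^{-α}`;
* `trunc_kpow_ball_ge` : the chain with jumps truncated at `ρ` keeps mass
  `≥ 1 − kε − (tail of Q)` in a ball;
* `kpow_ge_minorant` : a **common minorant**: for every `v ∈ B(x, r₁)` the law `Q n v ·`
  dominates `θ ∑_{k<n} ∑_{z∈S} Q (n-1-k) z ·` where `S` is a block of lattice points in the
  annulus `3r₁ < ‖z−x‖ ≤ 6r₁` (first long jump of Meyer's decomposition lands in `S`);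
* `kpow_near_diag_lower_even` : the **near-diagonal lower bound at even times**
  `Q (2n) x y ≥ c n^{-d/α}` for `‖x−y‖ ≤ A n^{1/α}`, by reversibility and Cauchy–Schwarz applied to
  the overlap `∑_z Q n x z · Q n y z ≥ ∑_z λ(z)²` of the two laws, `λ` the common minorant.

This replaces the parabolic Harnack inequality (Bass–Levin Thm 3.1) in the proof of their
Prop. 5.1. [folklore] (the overlap/Cauchy–Schwarz argument); statements cite Bass–Levin.

## References
* R. F. Bass, D. A. Levin, *Transition probabilities for symmetric jump processes*,
  Trans. Amer. Math. Soc. 354 (2002) 2933–2953, §5 (Prop. 5.1, Thm 5.2).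
-/

noncomputable section

namespace Literature.Probability.Process

open scoped BigOperators

variable {d : ℕ} {P K₁ K₂ : (Fin d → ℤ) → (Fin d → ℤ) → ℝ}
  {Q R : ℕ → (Fin d → ℤ) → (Fin d → ℤ) → ℝ} {μ : (Fin d → ℤ) → ℝ} {m M c₁ c₂ α ρ : ℝ}

/-! ### Tail bound from the off-diagonal upper bound -/

/-- **Tail bound from the off-diagonal upper bound**: if `Q n x y ≤ C_O n ‖x−y‖^{-(d+α)}` for
`‖x − y‖ ≥ n^{1/α}` (`n ≥ 1`), then for all `k ≥ 1`, `r > 0`,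
`∑_{‖z−x‖>r} Q k x z ≤ max(1, C_O 2^α(3^d + 2d3^{d-1}/α)) · k · r^{-α}`.
[cite: BassLevin2002, Thm 1.1 eq. (1.3)] -/
theorem kpow_far_le_of_offdiag (hd : 1 ≤ d) (hα : 0 < α) (hP0 : ∀ x y, 0 ≤ P x y)
    (hP1 : ∀ x, HasSum (P x) 1)
    (hQ0 : ∀ x y, Q 0 x y = if x = y then 1 else 0)
    (hQ : ∀ n x y, Q (n + 1) x y = ∑' z, Q n x z * P z y)
    {C_O : ℝ} (hCO : 0 ≤ C_O)
    (hoff : ∀ (n : ℕ) (x y : Fin d → ℤ), 1 ≤ n → (n : ℝ) ^ (1 / α) ≤ ‖x - y‖ →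
      Q n x y ≤ C_O * n * ‖x - y‖ ^ (-((d : ℝ) + α)))
    (k : ℕ) (x : Fin d → ℤ) (r : ℝ) (hk : 1 ≤ k) (hr : 0 < r) :
    ∑' z, {z | r < ‖z - x‖}.indicator (Q k x) z ≤
      max 1 (C_O * ((2 : ℝ) ^ α * (3 ^ d + 2 * d * 3 ^ (d - 1) / α))) * k * r ^ (-α) := by
  have hPs : ∀ x, Summable (P x) := fun x => (hP1 x).summable
  have hP1' : ∀ x, ∑' y, P x y ≤ 1 := fun x => ((hP1 x).tsum_eq).le
  have hQnn : ∀ k x w, 0 ≤ Q k x w := kpow_nonneg hP0 hQ0 hQ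
  set s : ℝ := (d : ℝ) + α with hs
  set Ct : ℝ := (2 : ℝ) ^ α * (3 ^ d + 2 * d * 3 ^ (d - 1) / α) with hCt
  have hCtnn : 0 ≤ Ct := by rw [hCt]; positivity
  set CT : ℝ := max 1 (C_O * Ct) with hCT
  have hCT0 : 0 ≤ CT := le_trans zero_le_one (le_max_left _ _)
  have hk0 : (0 : ℝ) < k := by exact_mod_cast hk
  have hsk : Summable (Q k x) := kpow_summable hP0 hPs hP1' hQ0 hQ k x
  have hfar1 : ∑' z, {z | r < ‖z - x‖}.indicator (Q k x) z ≤ 1 :=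
    (Summable.tsum_le_tsum (fun z => Set.indicator_le_self' (fun _ _ => hQnn k x z) z)
      (hsk.indicator _) hsk).trans (kpow_tsum_le_one hP0 hPs hP1' hQ0 hQ k x)
  have hrα : 0 < r ^ (-α) := Real.rpow_pos_of_pos hr _
  by_cases hrk : r < (k : ℝ) ^ (1 / α)
  · -- small radius: the bound is at least 1
    have h1 : 1 ≤ (k : ℝ) * r ^ (-α) := by
      have hrαk : r ^ α ≤ k := by
        calc r ^ α ≤ ((k : ℝ) ^ (1 / α)) ^ α := Real.rpow_le_rpow hr.le hrk.le hα.le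
          _ = k := by rw [← Real.rpow_mul hk0.le, one_div_mul_cancel hα.ne', Real.rpow_one]
      rw [Real.rpow_neg hr.le, ← div_eq_mul_inv, le_div_iff₀ (Real.rpow_pos_of_pos hr α),
        one_mul]
      exact hrαk
    calc ∑' z, {z | r < ‖z - x‖}.indicator (Q k x) z ≤ 1 := hfar1
      _ ≤ 1 * ((k : ℝ) * r ^ (-α)) := by linarith
      _ ≤ CT * ((k : ℝ) * r ^ (-α)) :=
          mul_le_mul_of_nonneg_right (le_max_left _ _) (by positivity)
      _ = CT * k * r ^ (-α) := by ring
  · push Not at hrk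
    obtain ⟨hfs, hfle⟩ := tsum_norm_rpow_neg_far_le hd hα hr
    have hpt : ∀ z, {z | r < ‖z - x‖}.indicator (Q k x) z ≤
        C_O * k * (if r < ‖z - x‖ then ‖z - x‖ ^ (-s) else 0) := by
      intro z
      by_cases hz : r < ‖z - x‖
      · have hz' : z ∈ {z | r < ‖z - x‖} := hz
        rw [Set.indicator_of_mem hz', if_pos hz]
        have hxz : (k : ℝ) ^ (1 / α) ≤ ‖x - z‖ := by rw [norm_sub_rev]; linarith
        have := hoff k x z hk hxz
        rwa [norm_sub_rev] at this
      · have hz' : z ∉ {z | r < ‖z - x‖} := hz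
        rw [Set.indicator_of_notMem hz', if_neg hz, mul_zero]
    have hmaj : Summable fun z => C_O * k * (if r < ‖z - x‖ then ‖z - x‖ ^ (-s) else 0) :=
      ((Equiv.subRight x).summable_iff.mpr hfs).mul_left _
    calc ∑' z, {z | r < ‖z - x‖}.indicator (Q k x) z
        ≤ ∑' z, C_O * k * (if r < ‖z - x‖ then ‖z - x‖ ^ (-s) else 0) :=
          Summable.tsum_le_tsum hpt (hsk.indicator _) hmaj
      _ = C_O * k * ∑' z, (if r < ‖z - x‖ then ‖z - x‖ ^ (-s) else 0) := tsum_mul_left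
      _ = C_O * k * ∑' h : Fin d → ℤ, (if r < ‖h‖ then ‖h‖ ^ (-s) else 0) := by
          congr 1
          exact (Equiv.subRight x).tsum_eq (fun h => if r < ‖h‖ then ‖h‖ ^ (-s) else 0)
      _ ≤ C_O * k * (Ct * r ^ (-α)) := mul_le_mul_of_nonneg_left hfle (by positivity)
      _ = (C_O * Ct) * ((k : ℝ) * r ^ (-α)) := by ring
      _ ≤ CT * ((k : ℝ) * r ^ (-α)) :=
          mul_le_mul_of_nonneg_right (le_max_right _ _) (by positivity)
      _ = CT * k * r ^ (-α) := by ring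

/-! ### Mass of the truncated chain in a ball -/

/-- **The truncated chain stays in a ball**: the mass of `R k v ·` (jumps truncated at `ρ`) in
`B(v, r₁)` is at least `1 − k · c₂ 2^α(3^d+2d3^{d-1}/α) ρ^{-α} − ∑_{‖z−v‖>r₁} Q k v z`.
[folklore] -/
theorem trunc_kpow_ball_ge (hd : 1 ≤ d) (hα : 0 < α) (hP0 : ∀ x y, 0 ≤ P x y)
    (hP1 : ∀ x, HasSum (P x) 1)
    (hub : ∀ x y, P x y ≤ c₂ * ‖x - y‖ ^ (-((d : ℝ) + α))) (hc₂ : 0 ≤ c₂) (hρ : 0 < ρ)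
    (hK₁ : ∀ w z, K₁ w z = if ‖w - z‖ ≤ ρ then P w z else 0)
    (hQ0 : ∀ x y, Q 0 x y = if x = y then 1 else 0)
    (hQ : ∀ n x y, Q (n + 1) x y = ∑' z, Q n x z * P z y)
    (hR0 : ∀ x y, R 0 x y = if x = y then 1 else 0)
    (hR : ∀ n x y, R (n + 1) x y = ∑' z, R n x z * K₁ z y) (k : ℕ) (v : Fin d → ℤ) (r₁ : ℝ) :
    1 - k * (c₂ * ((2 : ℝ) ^ α * (3 ^ d + 2 * d * 3 ^ (d - 1) / α)) * ρ ^ (-α)) -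
        ∑' z, {z | r₁ < ‖z - v‖}.indicator (Q k v) z ≤
      ∑' w, (Metric.closedBall v r₁).indicator (R k v) w := by
  have hPs : ∀ x, Summable (P x) := fun x => (hP1 x).summable
  have hP1' : ∀ x, ∑' y, P x y ≤ 1 := fun x => ((hP1 x).tsum_eq).le
  have hK₁nn : ∀ w z, 0 ≤ K₁ w z := trunc_nonneg hP0 hK₁
  have hK₁s : ∀ w, Summable (K₁ w) := trunc_summable hP0 hPs hK₁
  have hK₁1 : ∀ w, ∑' z, K₁ w z ≤ 1 := trunc_tsum_le_one hP0 hPs hP1' hK₁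
  have hRnn : ∀ k x w, 0 ≤ R k x w := kpow_nonneg hK₁nn hR0 hR
  have hRQ : ∀ k w z, R k w z ≤ Q k w z :=
    kpow_mono_kernel hK₁nn (trunc_le hP0 hK₁) hPs hP1' hR0 hR hQ0 hQ
  have hsR : Summable (R k v) := kpow_summable hK₁nn hK₁s hK₁1 hR0 hR k v
  have hsQ : Summable (Q k v) := kpow_summable hP0 hPs hP1' hQ0 hQ k v
  set B : Set (Fin d → ℤ) := Metric.closedBall v r₁ with hB
  have hsplit : ∑' w, B.indicator (R k v) w + ∑' w, Bᶜ.indicator (R k v) w = ∑' w, R k v w := by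
    rw [← Summable.tsum_add (hsR.indicator B) (hsR.indicator Bᶜ)]
    exact tsum_congr fun w => by
      rw [← Pi.add_apply (B.indicator (R k v)), Set.indicator_self_add_compl]
  have hcompl : ∑' w, Bᶜ.indicator (R k v) w ≤ ∑' z, {z | r₁ < ‖z - v‖}.indicator (Q k v) z := by
    refine Summable.tsum_le_tsum (fun w => ?_) (hsR.indicator _) (hsQ.indicator _)
    by_cases hw : w ∈ Bᶜ
    · have hw' : w ∈ {z | r₁ < ‖z - v‖} := by
        rw [Set.mem_compl_iff, hB, Metric.mem_closedBall, dist_eq_norm, not_le] at hw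
        exact hw
      rw [Set.indicator_of_mem hw, Set.indicator_of_mem hw']
      exact hRQ k v w
    · rw [Set.indicator_of_notMem hw]
      exact Set.indicator_nonneg (fun _ _ => kpow_nonneg hP0 hQ0 hQ k v _) _
  have hmass := trunc_kpow_tsum_ge hd hα hP0 hP1 hub hc₂ hρ hK₁ hR0 hR k v
  linarith

/-! ### The common minorant -/

/-- **Common minorant from the first long jump.** Truncate the jumps at `ρ = r₁` and let `R` be
the powers of the truncated kernel. If `v ∈ B(x, r₁)`, if the truncated chain from `v` keeps mass
`≥ θ₀` in `B(v, r₁)` at all times `k < n`, and if `S` is a finite set of lattice points in the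
annulus `3r₁ < ‖z−x‖ ≤ 6r₁`, then for every `z'`
`Q n v z' ≥ θ₀ c₁ (8r₁)^{-(d+α)} ∑_{k<n} ∑_{z∈S} Q (n-1-k) z z'`:
by Meyer's decomposition the paths whose first long jump (length `> r₁`, from `B(v,r₁)` into `S`,
at rate `≥ c₁ (8r₁)^{-(d+α)}`) occurs at time `k+1` contribute at least this much.
[cite: BassLevin2002, §5 proof of Thm 5.2] -/
theorem kpow_ge_minorant (hP0 : ∀ x y, 0 ≤ P x y) (hP1 : ∀ x, HasSum (P x) 1)
    (hlb : ∀ x y, c₁ * ‖x - y‖ ^ (-((d : ℝ) + α)) ≤ P x y) (hc₁ : 0 ≤ c₁)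
    (hαd : 0 ≤ (d : ℝ) + α) {r₁ : ℝ} (hr₁ : 0 < r₁)
    (hK₁ : ∀ w z, K₁ w z = if ‖w - z‖ ≤ r₁ then P w z else 0)
    (hK₂ : ∀ w z, K₂ w z = if ‖w - z‖ ≤ r₁ then 0 else P w z)
    (hQ0 : ∀ x y, Q 0 x y = if x = y then 1 else 0)
    (hQ : ∀ n x y, Q (n + 1) x y = ∑' z, Q n x z * P z y)
    (hR0 : ∀ x y, R 0 x y = if x = y then 1 else 0)
    (hR : ∀ n x y, R (n + 1) x y = ∑' z, R n x z * K₁ z y)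
    {n : ℕ} {x v : Fin d → ℤ} (hvx : ‖v - x‖ ≤ r₁) {θ₀ : ℝ}
    (hsurv : ∀ k, k < n → θ₀ ≤ ∑' w, (Metric.closedBall v r₁).indicator (R k v) w)
    (S : Finset (Fin d → ℤ)) (hS : ∀ z ∈ S, 3 * r₁ < ‖z - x‖ ∧ ‖z - x‖ ≤ 6 * r₁)
    (z' : Fin d → ℤ) :
    θ₀ * (c₁ * (8 * r₁) ^ (-((d : ℝ) + α))) *
        ∑ k ∈ Finset.range n, ∑ z ∈ S, Q (n - 1 - k) z z' ≤ Q n v z' := by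
  have hPs : ∀ x, Summable (P x) := fun x => (hP1 x).summable
  have hP1' : ∀ x, ∑' y, P x y ≤ 1 := fun x => ((hP1 x).tsum_eq).le
  have hK₁nn : ∀ w z, 0 ≤ K₁ w z := trunc_nonneg hP0 hK₁
  have hK₂nn : ∀ w z, 0 ≤ K₂ w z := bigJump_nonneg hP0 hK₂
  have hK₁s : ∀ w, Summable (K₁ w) := trunc_summable hP0 hPs hK₁
  have hK₁1 : ∀ w, ∑' z, K₁ w z ≤ 1 := trunc_tsum_le_one hP0 hPs hP1' hK₁
  have hK₂s : ∀ w, Summable (K₂ w) := bigJump_summable hP0 hPs hK₂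
  have hK₂1 : ∀ w z, K₂ w z ≤ 1 := fun w z =>
    (bigJump_le hP0 hK₂ w z).trans (kernel_le_one hP0 hPs hP1' w z)
  have hQnn : ∀ k x w, 0 ≤ Q k x w := kpow_nonneg hP0 hQ0 hQ
  have hRnn : ∀ k x w, 0 ≤ R k x w := kpow_nonneg hK₁nn hR0 hR
  set s : ℝ := (d : ℝ) + α with hs
  set θ : ℝ := c₁ * (8 * r₁) ^ (-s) with hθ
  have hθnn : 0 ≤ θ := mul_nonneg hc₁ (Real.rpow_nonneg (by positivity) _)
  have hmeyer := kpow_meyer (K := P) (Q := Q) (K₁ := K₁) (K₂ := K₂) (R := R) hK₁nn hK₂nn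
    (trunc_add_bigJump hK₁ hK₂) hPs hP1' hQ0 hQ hR0 hR n v z'
  -- the landing measure ν k z := ∑' w, R k v w * K₂ w z
  have hνnn : ∀ k z, 0 ≤ ∑' w, R k v w * K₂ w z :=
    fun k z => tsum_nonneg fun w => mul_nonneg (hRnn k v w) (hK₂nn w z)
  have hνs : ∀ k, Summable fun z => ∑' w, R k v w * K₂ w z := by
    intro k
    have h1 : ∀ w, Summable fun z => R k v w * K₂ w z := fun w => (hK₂s w).mul_left _
    have h2 : Summable fun w => ∑' z, R k v w * K₂ w z := by
      refine (kpow_summable hK₁nn hK₁s hK₁1 hR0 hR k v).of_nonneg_of_le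
        (fun w => tsum_nonneg fun z => mul_nonneg (hRnn k v w) (hK₂nn w z)) (fun w => ?_)
      rw [tsum_mul_left]
      refine mul_le_of_le_one_right (hRnn k v w) ?_
      exact (Summable.tsum_le_tsum (bigJump_le hP0 hK₂ w) (hK₂s w) (hPs w)).trans (hP1' w)
    exact (summable_swap_of_nonneg (fun w z => mul_nonneg (hRnn k v w) (hK₂nn w z)) h1 h2).2
  -- lower bound of the landing measure on S
  have hνS : ∀ k, k < n → ∀ z ∈ S, θ₀ * θ ≤ ∑' w, R k v w * K₂ w z := by
    intro k hk z hz
    obtain ⟨hz3, hz6⟩ := hS z hz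
    have hpt : ∀ w, (Metric.closedBall v r₁).indicator (R k v) w * θ ≤ R k v w * K₂ w z := by
      intro w
      by_cases hw : w ∈ Metric.closedBall v r₁
      · rw [Set.indicator_of_mem hw]
        rw [Metric.mem_closedBall, dist_eq_norm] at hw
        refine mul_le_mul_of_nonneg_left ?_ (hRnn k v w)
        -- geometry: r₁ < ‖w - z‖ ≤ 8 r₁
        have hzx : ‖z - x‖ ≤ ‖z - w‖ + ‖w - v‖ + ‖v - x‖ := by
          calc ‖z - x‖ = ‖(z - w) + (w - v) + (v - x)‖ := by congr 1; abel
            _ ≤ ‖(z - w) + (w - v)‖ + ‖v - x‖ := norm_add_le _ _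
            _ ≤ ‖z - w‖ + ‖w - v‖ + ‖v - x‖ := by gcongr; exact norm_add_le _ _
        have hwz1 : r₁ < ‖w - z‖ := by rw [norm_sub_rev]; linarith
        have hwz8 : ‖w - z‖ ≤ 8 * r₁ := by
          calc ‖w - z‖ = ‖(w - v) + (v - x) + (x - z)‖ := by congr 1; abel
            _ ≤ ‖(w - v) + (v - x)‖ + ‖x - z‖ := norm_add_le _ _
            _ ≤ ‖w - v‖ + ‖v - x‖ + ‖x - z‖ := by gcongr; exact norm_add_le _ _
            _ ≤ r₁ + r₁ + 6 * r₁ := by rw [norm_sub_rev x z]; gcongr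
            _ = 8 * r₁ := by ring
        have hwzpos : 0 < ‖w - z‖ := lt_trans hr₁ hwz1
        rw [hK₂, if_neg (not_le.mpr hwz1)]
        calc θ = c₁ * (8 * r₁) ^ (-s) := rfl
          _ ≤ c₁ * ‖w - z‖ ^ (-s) := mul_le_mul_of_nonneg_left
              (Real.rpow_le_rpow_of_nonpos hwzpos hwz8 (by rw [hs]; linarith)) hc₁
          _ ≤ P w z := hlb w z
      · rw [Set.indicator_of_notMem hw, zero_mul]
        exact mul_nonneg (hRnn k v w) (hK₂nn w z)
    have hsB : Summable fun w => (Metric.closedBall v r₁).indicator (R k v) w * θ :=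
      ((kpow_summable hK₁nn hK₁s hK₁1 hR0 hR k v).indicator _).mul_right _
    have hsRK : Summable fun w => R k v w * K₂ w z :=
      (kpow_summable hK₁nn hK₁s hK₁1 hR0 hR k v).of_nonneg_of_le
        (fun w => mul_nonneg (hRnn k v w) (hK₂nn w z))
        (fun w => mul_le_of_le_one_right (hRnn k v w) (hK₂1 w z))
    calc θ₀ * θ ≤ (∑' w, (Metric.closedBall v r₁).indicator (R k v) w) * θ :=
          mul_le_mul_of_nonneg_right (hsurv k hk) hθnn
      _ = ∑' w, (Metric.closedBall v r₁).indicator (R k v) w * θ := tsum_mul_right.symm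
      _ ≤ ∑' w, R k v w * K₂ w z := Summable.tsum_le_tsum hpt hsB hsRK
  -- drop the truncated part and restrict the landing point to S
  have hterm : ∀ k ∈ Finset.range n,
      ∑ z ∈ S, θ₀ * θ * Q (n - 1 - k) z z' ≤
        ∑' z, (∑' w, R k v w * K₂ w z) * Q (n - 1 - k) z z' := by
    intro k hk
    have hk' : k < n := Finset.mem_range.mp hk
    have hsum : Summable fun z => (∑' w, R k v w * K₂ w z) * Q (n - 1 - k) z z' :=
      (hνs k).of_nonneg_of_le (fun z => mul_nonneg (hνnn k z) (hQnn _ z z'))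
        (fun z => mul_le_of_le_one_right (hνnn k z) (kpow_le_one hP0 hPs hP1' hQ0 hQ _ z z'))
    calc ∑ z ∈ S, θ₀ * θ * Q (n - 1 - k) z z'
        ≤ ∑ z ∈ S, (∑' w, R k v w * K₂ w z) * Q (n - 1 - k) z z' :=
          Finset.sum_le_sum fun z hz =>
            mul_le_mul_of_nonneg_right (hνS k hk' z hz) (hQnn _ z z')
      _ ≤ ∑' z, (∑' w, R k v w * K₂ w z) * Q (n - 1 - k) z z' :=
          hsum.sum_le_tsum S (fun z _ => mul_nonneg (hνnn k z) (hQnn _ z z'))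
  calc θ₀ * (c₁ * (8 * r₁) ^ (-s)) * ∑ k ∈ Finset.range n, ∑ z ∈ S, Q (n - 1 - k) z z'
      = ∑ k ∈ Finset.range n, ∑ z ∈ S, θ₀ * θ * Q (n - 1 - k) z z' := by
        rw [Finset.mul_sum]
        exact Finset.sum_congr rfl fun k _ => by rw [Finset.mul_sum]
    _ ≤ ∑ k ∈ Finset.range n, ∑' z, (∑' w, R k v w * K₂ w z) * Q (n - 1 - k) z z' :=
        Finset.sum_le_sum hterm
    _ ≤ R n v z' + ∑ k ∈ Finset.range n, ∑' z, (∑' w, R k v w * K₂ w z) * Q (n - 1 - k) z z' :=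
        le_add_of_nonneg_left (hRnn n v z')
    _ = Q n v z' := hmeyer.symm


/-! ### Small helpers on laws of the chain -/

/-- At time `0` no mass is far away. [folklore] -/
theorem kpow_far_zero (hQ0 : ∀ x y, Q 0 x y = if x = y then 1 else 0) {r : ℝ} (hr : 0 ≤ r)
    (v : Fin d → ℤ) : ∑' z, {z | r < ‖z - v‖}.indicator (Q 0 v) z = 0 := by
  have : (fun z => {z | r < ‖z - v‖}.indicator (Q 0 v) z) = fun _ => 0 := by
    funext z
    by_cases hz : z ∈ {z | r < ‖z - v‖}
    · rw [Set.indicator_of_mem hz, hQ0]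
      have hz' : r < ‖z - v‖ := hz
      have : v ≠ z := by
        intro h; rw [h, sub_self, norm_zero] at hz'; linarith
      simp [this]
    · rw [Set.indicator_of_notMem hz]
  rw [this, tsum_zero]

/-- Mass in a ball equals one minus the far mass (Markov kernel). [folklore] -/
theorem kpow_ball_mass_eq (hP0 : ∀ x y, 0 ≤ P x y) (hP1 : ∀ x, HasSum (P x) 1)
    (hQ0 : ∀ x y, Q 0 x y = if x = y then 1 else 0)
    (hQ : ∀ n x y, Q (n + 1) x y = ∑' z, Q n x z * P z y) (j : ℕ) (v : Fin d → ℤ) (r : ℝ) :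
    ∑' z, (Metric.closedBall v r).indicator (Q j v) z =
      1 - ∑' z, {z | r < ‖z - v‖}.indicator (Q j v) z := by
  have hPs : ∀ x, Summable (P x) := fun x => (hP1 x).summable
  have hP1' : ∀ x, ∑' y, P x y ≤ 1 := fun x => ((hP1 x).tsum_eq).le
  have hs : Summable (Q j v) := kpow_summable hP0 hPs hP1' hQ0 hQ j v
  set B : Set (Fin d → ℤ) := Metric.closedBall v r with hB
  have hc : ∀ z, Bᶜ.indicator (Q j v) z = {z | r < ‖z - v‖}.indicator (Q j v) z := by
    intro z
    by_cases hz : z ∈ Bᶜ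
    · have hz' : z ∈ {z | r < ‖z - v‖} := by
        rw [Set.mem_compl_iff, hB, Metric.mem_closedBall, dist_eq_norm, not_le] at hz; exact hz
      rw [Set.indicator_of_mem hz, Set.indicator_of_mem hz']
    · have hz' : z ∉ {z | r < ‖z - v‖} := by
        intro h
        apply hz
        rw [Set.mem_compl_iff, hB, Metric.mem_closedBall, dist_eq_norm, not_le]; exact h
      rw [Set.indicator_of_notMem hz, Set.indicator_of_notMem hz']
  have hsplit : ∑' z, B.indicator (Q j v) z + ∑' z, Bᶜ.indicator (Q j v) z = 1 := by
    rw [← Summable.tsum_add (hs.indicator B) (hs.indicator Bᶜ)]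
    have : (fun z => B.indicator (Q j v) z + Bᶜ.indicator (Q j v) z) = Q j v := by
      funext z; rw [← Pi.add_apply (B.indicator (Q j v)), Set.indicator_self_add_compl]
    rw [this]; exact kpow_tsum_eq_one hP0 hP1 hQ0 hQ j v
  rw [tsum_congr hc] at hsplit
  linarith

/-- Mass of a finite set containing a ball is at least the mass of the ball. [folklore] -/
theorem kpow_finset_sum_ge_ball (hP0 : ∀ x y, 0 ≤ P x y) (hP1 : ∀ x, HasSum (P x) 1)
    (hQ0 : ∀ x y, Q 0 x y = if x = y then 1 else 0)
    (hQ : ∀ n x y, Q (n + 1) x y = ∑' z, Q n x z * P z y) (j : ℕ) (v : Fin d → ℤ) (r : ℝ)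
    (B' : Finset (Fin d → ℤ)) (hB' : Metric.closedBall v r ⊆ (B' : Set (Fin d → ℤ))) :
    ∑' z, (Metric.closedBall v r).indicator (Q j v) z ≤ ∑ z ∈ B', Q j v z := by
  have hPs : ∀ x, Summable (P x) := fun x => (hP1 x).summable
  have hP1' : ∀ x, ∑' y, P x y ≤ 1 := fun x => ((hP1 x).tsum_eq).le
  have hs : Summable (Q j v) := kpow_summable hP0 hPs hP1' hQ0 hQ j v
  have hQnn : ∀ k x w, 0 ≤ Q k x w := kpow_nonneg hP0 hQ0 hQ
  rw [sum_eq_tsum_indicator]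
  exact Summable.tsum_le_tsum
    (Set.indicator_le_indicator_of_subset hB' (fun _ => hQnn j v _)) (hs.indicator _)
    (hs.indicator _)

/-- The overlap of the laws from `x` and `y` is dominated by the two-step return:
`∑' z, Q n x z * Q n y z ≤ (M/m) Q (n+n) x y` (reversibility). [folklore] -/
theorem tsum_kpow_mul_kpow_le (hP0 : ∀ x y, 0 ≤ P x y) (hP1 : ∀ x, HasSum (P x) 1)
    (hμ : ∀ x, m ≤ μ x ∧ μ x ≤ M) (hm : 0 < m)
    (hrev : ∀ x y, μ x * P x y = μ y * P y x)
    (hQ0 : ∀ x y, Q 0 x y = if x = y then 1 else 0)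
    (hQ : ∀ n x y, Q (n + 1) x y = ∑' z, Q n x z * P z y) (n : ℕ) (x y : Fin d → ℤ) :
    (Summable fun z => Q n x z * Q n y z) ∧
      ∑' z, Q n x z * Q n y z ≤ M / m * Q (n + n) x y := by
  have hPs : ∀ x, Summable (P x) := fun x => (hP1 x).summable
  have hP1' : ∀ x, ∑' y, P x y ≤ 1 := fun x => ((hP1 x).tsum_eq).le
  have hQnn : ∀ k x w, 0 ≤ Q k x w := kpow_nonneg hP0 hQ0 hQ
  have hμpos : ∀ x, 0 < μ x := fun x => lt_of_lt_of_le hm (hμ x).1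
  have hM : 0 < M := lt_of_lt_of_le hm ((hμ y).1.trans (hμ y).2)
  have hs : Summable fun z => Q n x z * Q n y z :=
    (kpow_summable hP0 hPs hP1' hQ0 hQ n x).of_nonneg_of_le
      (fun z => mul_nonneg (hQnn n x z) (hQnn n y z))
      (fun z => mul_le_of_le_one_right (hQnn n x z) (kpow_le_one hP0 hPs hP1' hQ0 hQ n y z))
  refine ⟨hs, ?_⟩
  have hrel : ∀ z, Q n y z ≤ M / m * Q n z y := by
    intro z
    have hr := kpow_reversible hP0 hPs hP1' hQ0 hQ hrev n y z
    have : Q n y z = (μ z / μ y) * Q n z y := by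
      rw [div_mul_eq_mul_div, eq_div_iff (hμpos y).ne']
      calc Q n y z * μ y = μ y * Q n y z := mul_comm _ _
        _ = μ z * Q n z y := hr
    rw [this]
    exact mul_le_mul_of_nonneg_right (div_le_div₀ hM.le (hμ z).2 hm (hμ y).1) (hQnn n z y)
  have hpt : ∀ z, Q n x z * Q n y z ≤ M / m * (Q n x z * Q n z y) := by
    intro z
    calc Q n x z * Q n y z ≤ Q n x z * (M / m * Q n z y) :=
          mul_le_mul_of_nonneg_left (hrel z) (hQnn n x z)
      _ = M / m * (Q n x z * Q n z y) := by ring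
  calc ∑' z, Q n x z * Q n y z ≤ ∑' z, M / m * (Q n x z * Q n z y) :=
        Summable.tsum_le_tsum hpt hs ((summable_kpow_mul_kpow hP0 hPs hP1' hQ0 hQ n n x y).mul_left _)
    _ = M / m * ∑' z, Q n x z * Q n z y := tsum_mul_left
    _ = M / m * Q (n + n) x y := by rw [← kpow_add hP0 hPs hP1' hQ0 hQ n n x y]

/-! ### Two pieces of lattice geometry -/

/-- **A block in an annulus.** For `r₁ ≥ 1` and `x ∈ ℤ^d` (`d ≥ 1`) there is a finite set `S` of
lattice points with `(r₁/2)^d ≤ #S` and `3r₁ < ‖z − x‖ ≤ 6r₁` for all `z ∈ S` (a box of radius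
`⌊r₁/2⌋` centred at `x + ⌈4r₁⌉ e₀`). [folklore] -/
theorem exists_annulus_block (hd : 1 ≤ d) {r₁ : ℝ} (hr₁1 : 1 ≤ r₁) (x : Fin d → ℤ) :
    ∃ S : Finset (Fin d → ℤ), (r₁ / 2) ^ (d : ℝ) ≤ S.card ∧
      ∀ z ∈ S, 3 * r₁ < ‖z - x‖ ∧ ‖z - x‖ ≤ 6 * r₁ := by
  have hr₁0 : 0 < r₁ := lt_of_lt_of_le one_pos hr₁1
  obtain ⟨i₀⟩ : Nonempty (Fin d) := ⟨⟨0, hd⟩⟩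
  set cN : ℕ := ⌈4 * r₁⌉₊ with hcN
  set t : ℕ := ⌊r₁ / 2⌋₊ with ht
  set u : Fin d → ℤ := Pi.single i₀ (cN : ℤ) with hu
  have hnu : ‖u‖ = cN := by
    rw [hu, Pi.norm_single, Int.norm_eq_abs]; push_cast; exact abs_of_nonneg (Nat.cast_nonneg _)
  have hui : u i₀ = cN := by simp [hu]
  have hcN4 : 4 * r₁ ≤ cN := Nat.le_ceil _
  have hcN5 : (cN : ℝ) < 4 * r₁ + 1 := Nat.ceil_lt_add_one (by positivity)
  have ht2 : (t : ℝ) ≤ r₁ / 2 := Nat.floor_le (by positivity)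
  have ht1 : r₁ / 2 ≤ 2 * (t : ℝ) + 1 := by
    have := Nat.lt_floor_add_one (r₁ / 2); linarith
  set S : Finset (Fin d → ℤ) := (Fintype.piFinset fun _ : Fin d => Finset.Icc (-(t : ℤ)) t).map
    (Equiv.addRight (x + u)).toEmbedding with hSdef
  have hScard : (S.card : ℝ) = (2 * (t : ℝ) + 1) ^ d := by
    rw [hSdef, card_box_add]; push_cast; ring
  refine ⟨S, ?_, fun z hz => ?_⟩
  · rw [hScard, ← Real.rpow_natCast]
    exact Real.rpow_le_rpow (by positivity) ht1 (Nat.cast_nonneg d)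
  · rw [hSdef, mem_box_add_iff] at hz
    set h : Fin d → ℤ := z - (x + u) with hh
    have hzx : z - x = h + u := by rw [hh]; abel
    have hhi : |((h i₀ : ℤ) : ℝ)| ≤ ‖h‖ := by
      have := norm_le_pi_norm h i₀
      rw [Int.norm_eq_abs] at this
      exact_mod_cast this
    constructor
    · have hcoord : |(((z - x) i₀ : ℤ) : ℝ)| ≤ ‖z - x‖ := by
        have := norm_le_pi_norm (z - x) i₀
        rw [Int.norm_eq_abs] at this
        exact_mod_cast this
      have hzi : (((z - x) i₀ : ℤ) : ℝ) = ((h i₀ : ℤ) : ℝ) + cN := by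
        rw [hzx, Pi.add_apply, hui]; push_cast; ring
      have hlow : (cN : ℝ) - |((h i₀ : ℤ) : ℝ)| ≤ ‖z - x‖ := by
        calc (cN : ℝ) - |((h i₀ : ℤ) : ℝ)| ≤ ((h i₀ : ℤ) : ℝ) + cN := by
              linarith [neg_abs_le ((h i₀ : ℤ) : ℝ)]
          _ ≤ |((h i₀ : ℤ) : ℝ) + cN| := le_abs_self _
          _ = |(((z - x) i₀ : ℤ) : ℝ)| := by rw [hzi]
          _ ≤ ‖z - x‖ := hcoord
      linarith
    · calc ‖z - x‖ = ‖h + u‖ := by rw [hzx]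
        _ ≤ ‖h‖ + ‖u‖ := norm_add_le _ _
        _ ≤ t + cN := by rw [hnu]; exact add_le_add hz le_rfl
        _ ≤ 6 * r₁ := by linarith

/-- **A box containing all unit-scale balls around the annulus.** For `r₁ ≥ 1` and `x ∈ ℤ^d` the
box `B' = {‖z' − x‖ ≤ ⌊7r₁⌋}` has `#B' ≤ (15 r₁)^d`, contains `x`, and contains `B(z, r₁)`
whenever `‖z − x‖ ≤ 6r₁`. [folklore] -/
theorem exists_cover_box {r₁ : ℝ} (hr₁1 : 1 ≤ r₁) (x : Fin d → ℤ) :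
    ∃ B' : Finset (Fin d → ℤ), (B'.card : ℝ) ≤ (15 * r₁) ^ (d : ℝ) ∧ x ∈ B' ∧
      ∀ z : Fin d → ℤ, ‖z - x‖ ≤ 6 * r₁ → Metric.closedBall z r₁ ⊆ (B' : Set (Fin d → ℤ)) := by
  have hr₁0 : 0 < r₁ := lt_of_lt_of_le one_pos hr₁1
  set N' : ℕ := ⌊7 * r₁⌋₊ with hN'
  set B' : Finset (Fin d → ℤ) := (Fintype.piFinset fun _ : Fin d => Finset.Icc (-(N' : ℤ)) N').map
    (Equiv.addRight x).toEmbedding with hB'def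
  refine ⟨B', ?_, ?_, fun z hz z' hz' => ?_⟩
  · rw [hB'def, card_box_add, Real.rpow_natCast]; push_cast
    have hN'le : (N' : ℝ) ≤ 7 * r₁ := Nat.floor_le (by positivity)
    have : 2 * (N' : ℝ) + 1 ≤ 15 * r₁ := by linarith
    exact pow_le_pow_left₀ (by positivity) this d
  · rw [hB'def, mem_box_add_iff]; simp
  · rw [Metric.mem_closedBall, dist_eq_norm] at hz'
    have h7 : ‖z' - x‖ ≤ 7 * r₁ := by
      calc ‖z' - x‖ = ‖(z' - z) + (z - x)‖ := by congr 1; abel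
        _ ≤ ‖z' - z‖ + ‖z - x‖ := norm_add_le _ _
        _ ≤ r₁ + 6 * r₁ := add_le_add hz' hz
        _ = 7 * r₁ := by ring
    rw [Finset.mem_coe, hB'def, mem_box_add_iff]
    exact (norm_le_iff_norm_le_floor (z' - x) (by positivity)).mp h7

/-! ### Near-diagonal lower bound at even times -/

/-- **Near-diagonal lower bound at even times (Bass–Levin Prop. 5.1, even times, PHI-free).**
Under the two-sided kernel bounds, reversibility and the tail bound
`∑_{‖z−x‖>r} Q k x z ≤ C_T k r^{-α}`, for every `A ≥ 1` with
`(c₂ 2^α(3^d+2d3^{d-1}/α) + C_T) A^{-α} ≤ 1/2` there is `c > 0` with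
`Q (2n) x y ≥ c n^{-d/α}` whenever `n ≥ 1` and `‖x − y‖ ≤ A n^{1/α}`.
Proof: with `r₁ = A n^{1/α}`, both laws `Q n x ·`, `Q n y ·` dominate the common minorant
`λ = (1/2) c₁ (8r₁)^{-(d+α)} ∑_{k<n} ∑_{z∈S} Q (n-1-k) z ·` (`kpow_ge_minorant`, `S` a block of
`≍ r₁^d` points in the annulus `3r₁ < ‖z−x‖ ≤ 6r₁`), whose mass in `B(x, 7r₁)` is `≥ c A^{-α}`;
then `Q (2n) x y ≥ (m/M) ∑_z λ(z)² ≥ (m/M) (∑_{B(x,7r₁)} λ)² / #B(x,7r₁)` by reversibility and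
Cauchy–Schwarz. [cite: BassLevin2002, Prop. 5.1] -/
theorem kpow_near_diag_lower_even (hd : 1 ≤ d) (hα : 0 < α) (hP0 : ∀ x y, 0 ≤ P x y)
    (hP1 : ∀ x, HasSum (P x) 1)
    (hμ : ∀ x, m ≤ μ x ∧ μ x ≤ M) (hm : 0 < m)
    (hrev : ∀ x y, μ x * P x y = μ y * P y x)
    (hlb : ∀ x y, c₁ * ‖x - y‖ ^ (-((d : ℝ) + α)) ≤ P x y) (hc₁ : 0 < c₁)
    (hub : ∀ x y, P x y ≤ c₂ * ‖x - y‖ ^ (-((d : ℝ) + α))) (hc₂ : 0 ≤ c₂)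
    (hQ0 : ∀ x y, Q 0 x y = if x = y then 1 else 0)
    (hQ : ∀ n x y, Q (n + 1) x y = ∑' z, Q n x z * P z y)
    {C_T : ℝ} (hCT : 0 ≤ C_T)
    (htail : ∀ (k : ℕ) (x : Fin d → ℤ) (r : ℝ), 1 ≤ k → 0 < r →
      ∑' z, {z | r < ‖z - x‖}.indicator (Q k x) z ≤ C_T * k * r ^ (-α))
    {A : ℝ} (hA1 : 1 ≤ A)
    (hA : (c₂ * ((2 : ℝ) ^ α * (3 ^ d + 2 * d * 3 ^ (d - 1) / α)) + C_T) * A ^ (-α) ≤ 1 / 2) :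
    ∃ c : ℝ, 0 < c ∧ ∀ (n : ℕ) (x y : Fin d → ℤ), 1 ≤ n → ‖x - y‖ ≤ A * (n : ℝ) ^ (1 / α) →
      c * (n : ℝ) ^ (-(d : ℝ) / α) ≤ Q (n + n) x y := by
  have hPs : ∀ x, Summable (P x) := fun x => (hP1 x).summable
  have hP1' : ∀ x, ∑' y, P x y ≤ 1 := fun x => ((hP1 x).tsum_eq).le
  have hQnn : ∀ k x w, 0 ≤ Q k x w := kpow_nonneg hP0 hQ0 hQ
  have hM : 0 < M := lt_of_lt_of_le hm ((hμ 0).1.trans (hμ 0).2)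
  have hA0 : 0 < A := lt_of_lt_of_le one_pos hA1
  set s : ℝ := (d : ℝ) + α with hs
  have hspos : 0 < s := by rw [hs]; positivity
  set Ct : ℝ := (2 : ℝ) ^ α * (3 ^ d + 2 * d * 3 ^ (d - 1) / α) with hCt
  have hCtnn : 0 ≤ Ct := by rw [hCt]; positivity
  -- the constant
  set κ : ℝ := c₁ * (8 : ℝ) ^ (-s) * (2 : ℝ) ^ (-(d : ℝ)) / 4 * A ^ (-α) with hκ
  have hκnn : 0 ≤ κ := by rw [hκ]; positivity
  set c : ℝ := m / M * κ ^ 2 * ((15 : ℝ) ^ (-(d : ℝ)) * A ^ (-(d : ℝ))) with hc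
  refine ⟨c, by positivity, fun n x y hn hxy => ?_⟩
  have hn0 : (0 : ℝ) < n := by exact_mod_cast hn
  have hn1 : (1 : ℝ) ≤ n := by exact_mod_cast hn
  have hnα : 0 < (n : ℝ) ^ (1 / α) := Real.rpow_pos_of_pos hn0 _
  have hnα1 : 1 ≤ (n : ℝ) ^ (1 / α) := Real.one_le_rpow hn1 (by positivity)
  set r₁ : ℝ := A * (n : ℝ) ^ (1 / α) with hr₁
  have hr₁0 : 0 < r₁ := mul_pos hA0 hnα
  have hr₁1 : 1 ≤ r₁ := by rw [hr₁]; nlinarith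
  have hpow1 : ((n : ℝ) ^ (1 / α)) ^ (-α) = (n : ℝ)⁻¹ := by
    rw [← Real.rpow_mul hn0.le, show (1 / α) * (-α) = -1 by field_simp, Real.rpow_neg_one]
  have hr₁α : r₁ ^ (-α) = A ^ (-α) * (n : ℝ)⁻¹ := by
    rw [hr₁, Real.mul_rpow hA0.le hnα.le, hpow1]
  -- truncation at ρ = r₁
  set K₁ : (Fin d → ℤ) → (Fin d → ℤ) → ℝ := fun w z => if ‖w - z‖ ≤ r₁ then P w z else 0
    with hK₁def
  set K₂ : (Fin d → ℤ) → (Fin d → ℤ) → ℝ := fun w z => if ‖w - z‖ ≤ r₁ then 0 else P w z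
    with hK₂def
  have hK₁ : ∀ w z, K₁ w z = if ‖w - z‖ ≤ r₁ then P w z else 0 := fun w z => rfl
  have hK₂ : ∀ w z, K₂ w z = if ‖w - z‖ ≤ r₁ then 0 else P w z := fun w z => rfl
  obtain ⟨R, hR0, hR⟩ := exists_kpow K₁
  -- far mass of Q beyond r₁ at times ≤ n
  have hAα : 0 ≤ A ^ (-α) := Real.rpow_nonneg hA0.le _
  have hfar : ∀ (k : ℕ) (v : Fin d → ℤ), k ≤ n →
      ∑' z, {z | r₁ < ‖z - v‖}.indicator (Q k v) z ≤ C_T * A ^ (-α) := by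
    intro k v hk
    rcases Nat.eq_zero_or_pos k with h0 | hkpos
    · subst h0; rw [kpow_far_zero hQ0 hr₁0.le v]; positivity
    · calc _ ≤ C_T * k * r₁ ^ (-α) := htail k v r₁ hkpos hr₁0
        _ ≤ C_T * n * r₁ ^ (-α) := by gcongr
        _ = C_T * A ^ (-α) := by rw [hr₁α]; field_simp
  have hA' : c₂ * Ct * A ^ (-α) + C_T * A ^ (-α) ≤ 1 / 2 := by
    have : (c₂ * Ct + C_T) * A ^ (-α) = c₂ * Ct * A ^ (-α) + C_T * A ^ (-α) := by ring
    linarith [hA]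
  have hCT' : C_T * A ^ (-α) ≤ 1 / 2 := by
    nlinarith [hA', mul_nonneg (mul_nonneg hc₂ hCtnn) hAα]
  -- survival of the truncated chain in B(v, r₁)
  have hsurv : ∀ (v : Fin d → ℤ) (k : ℕ), k ≤ n →
      (1 / 2 : ℝ) ≤ ∑' w, (Metric.closedBall v r₁).indicator (R k v) w := by
    intro v k hk
    have h := trunc_kpow_ball_ge hd hα hP0 hP1 hub hc₂ hr₁0 hK₁ hQ0 hQ hR0 hR k v r₁
    have h1 : (k : ℝ) * (c₂ * Ct * r₁ ^ (-α)) ≤ c₂ * Ct * A ^ (-α) := by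
      calc (k : ℝ) * (c₂ * Ct * r₁ ^ (-α)) ≤ n * (c₂ * Ct * r₁ ^ (-α)) := by gcongr
        _ = c₂ * Ct * A ^ (-α) := by rw [hr₁α]; field_simp
    have h2 := hfar k v hk
    linarith
  -- geometry: the block S in the annulus and the big box B'
  obtain ⟨S, hSge, hS⟩ := exists_annulus_block hd hr₁1 x
  obtain ⟨B', hB'card, -, hcov⟩ := exists_cover_box (d := d) hr₁1 x
  have hballB' : ∀ z ∈ S, Metric.closedBall z r₁ ⊆ (B' : Set (Fin d → ℤ)) :=
    fun z hz => hcov z (hS z hz).2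
  -- mass in B' at times ≤ n from points of S is at least 1/2
  have hmassB' : ∀ z ∈ S, ∀ j, j ≤ n → (1 / 2 : ℝ) ≤ ∑ z' ∈ B', Q j z z' := by
    intro z hz j hj
    have h1 := kpow_finset_sum_ge_ball hP0 hP1 hQ0 hQ j z r₁ B' (hballB' z hz)
    rw [kpow_ball_mass_eq hP0 hP1 hQ0 hQ j z r₁] at h1
    have h2 := hfar j z hj
    linarith
  -- the common minorant
  set θ : ℝ := c₁ * (8 * r₁) ^ (-s) with hθ
  have hθnn : 0 ≤ θ := mul_nonneg hc₁.le (Real.rpow_nonneg (by positivity) _)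
  have hmin : ∀ v, ‖v - x‖ ≤ r₁ → ∀ z',
      1 / 2 * θ * ∑ k ∈ Finset.range n, ∑ z ∈ S, Q (n - 1 - k) z z' ≤ Q n v z' := by
    intro v hv z'
    exact kpow_ge_minorant hP0 hP1 hlb hc₁.le hspos.le hr₁0 hK₁ hK₂ hQ0 hQ hR0 hR hv
      (fun k hk => hsurv v k hk.le) S hS z'
  set lam : (Fin d → ℤ) → ℝ := fun z' =>
    1 / 2 * θ * ∑ k ∈ Finset.range n, ∑ z ∈ S, Q (n - 1 - k) z z' with hlam
  have hlamnn : ∀ z', 0 ≤ lam z' := fun z' =>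
    mul_nonneg (mul_nonneg (by norm_num) hθnn)
      (Finset.sum_nonneg fun k _ => Finset.sum_nonneg fun z _ => hQnn _ z z')
  have hlamx : ∀ z', lam z' ≤ Q n x z' := hmin x (by rw [sub_self, norm_zero]; exact hr₁0.le)
  have hlamy : ∀ z', lam z' ≤ Q n y z' := hmin y (by rw [norm_sub_rev]; exact hxy)
  -- mass of the minorant in B'
  have hΛ : 1 / 2 * θ * (n * S.card / 2) ≤ ∑ z' ∈ B', lam z' := by
    have hexp : ∑ z' ∈ B', lam z' =
        1 / 2 * θ * ∑ k ∈ Finset.range n, ∑ z ∈ S, ∑ z' ∈ B', Q (n - 1 - k) z z' := by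
      rw [hlam, ← Finset.mul_sum, Finset.sum_comm]
      congr 1
      exact Finset.sum_congr rfl fun k _ => Finset.sum_comm
    rw [hexp]
    refine mul_le_mul_of_nonneg_left ?_ (by positivity)
    calc (n : ℝ) * S.card / 2 = ∑ k ∈ Finset.range n, ∑ z ∈ S, (1 / 2 : ℝ) := by
          rw [Finset.sum_const, Finset.card_range, Finset.sum_const, nsmul_eq_mul, nsmul_eq_mul]
          ring
      _ ≤ ∑ k ∈ Finset.range n, ∑ z ∈ S, ∑ z' ∈ B', Q (n - 1 - k) z z' :=
          Finset.sum_le_sum fun k _ => Finset.sum_le_sum fun z hz =>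
            hmassB' z hz (n - 1 - k) (by omega)
  -- Cauchy–Schwarz
  have hCS : (∑ z' ∈ B', lam z') ^ 2 ≤ B'.card * ∑ z' ∈ B', lam z' ^ 2 :=
    sq_sum_le_card_mul_sum_sq
  have hsq : ∑ z' ∈ B', lam z' ^ 2 ≤ M / m * Q (n + n) x y := by
    obtain ⟨hsum, hle⟩ := tsum_kpow_mul_kpow_le hP0 hP1 hμ hm hrev hQ0 hQ n x y
    calc ∑ z' ∈ B', lam z' ^ 2 ≤ ∑ z' ∈ B', Q n x z' * Q n y z' :=
          Finset.sum_le_sum fun z' _ => by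
            rw [sq]; exact mul_le_mul (hlamx z') (hlamy z') (hlamnn z') (hQnn n x z')
      _ ≤ ∑' z', Q n x z' * Q n y z' :=
          hsum.sum_le_tsum B' (fun z' _ => mul_nonneg (hQnn _ _ _) (hQnn _ _ _))
      _ ≤ M / m * Q (n + n) x y := hle
  have hΛnn : 0 ≤ 1 / 2 * θ * (n * S.card / 2) := by positivity
  have key : (1 / 2 * θ * (n * S.card / 2)) ^ 2 ≤ B'.card * (M / m * Q (n + n) x y) := by
    calc _ ≤ (∑ z' ∈ B', lam z') ^ 2 := pow_le_pow_left₀ hΛnn hΛ 2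
      _ ≤ B'.card * ∑ z' ∈ B', lam z' ^ 2 := hCS
      _ ≤ B'.card * (M / m * Q (n + n) x y) :=
          mul_le_mul_of_nonneg_left hsq (Nat.cast_nonneg _)
  -- constants: κ ≤ (1/2) θ (n |S| / 2)
  have h8 : (8 * r₁) ^ (-s) = (8 : ℝ) ^ (-s) * r₁ ^ (-s) := Real.mul_rpow (by norm_num) hr₁0.le
  have hhalf : (r₁ / 2) ^ (d : ℝ) = r₁ ^ (d : ℝ) * (2 : ℝ) ^ (-(d : ℝ)) := by
    rw [Real.div_rpow hr₁0.le (by norm_num), Real.rpow_neg (by norm_num : (0 : ℝ) ≤ 2),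
      div_eq_mul_inv]
  have hr₁ds : r₁ ^ (-s) * r₁ ^ (d : ℝ) = r₁ ^ (-α) := by
    rw [← Real.rpow_add hr₁0]; congr 1; rw [hs]; ring
  have hκle : κ ≤ 1 / 2 * θ * (n * S.card / 2) := by
    have hL : κ = 1 / 2 * θ * (n * (r₁ / 2) ^ (d : ℝ) / 2) := by
      calc κ = c₁ * (8 : ℝ) ^ (-s) * (2 : ℝ) ^ (-(d : ℝ)) / 4 * (A ^ (-α) * (n : ℝ)⁻¹) * n := by
            rw [hκ]; field_simp
        _ = c₁ * (8 : ℝ) ^ (-s) * (2 : ℝ) ^ (-(d : ℝ)) / 4 * (r₁ ^ (-s) * r₁ ^ (d : ℝ)) * n := by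
            rw [hr₁ds, hr₁α]
        _ = 1 / 2 * θ * (n * (r₁ / 2) ^ (d : ℝ) / 2) := by rw [hθ, h8, hhalf]; ring
    rw [hL]
    refine mul_le_mul_of_nonneg_left ?_ (by positivity)
    exact div_le_div_of_nonneg_right (mul_le_mul_of_nonneg_left hSge hn0.le) (by norm_num)
  -- conclude
  have hX : 0 < (15 * r₁) ^ (d : ℝ) := Real.rpow_pos_of_pos (by positivity) _
  have hfin : κ ^ 2 ≤ (15 * r₁) ^ (d : ℝ) * (M / m * Q (n + n) x y) := by
    calc κ ^ 2 ≤ (1 / 2 * θ * (n * S.card / 2)) ^ 2 := pow_le_pow_left₀ hκnn hκle 2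
      _ ≤ B'.card * (M / m * Q (n + n) x y) := key
      _ ≤ (15 * r₁) ^ (d : ℝ) * (M / m * Q (n + n) x y) :=
          mul_le_mul_of_nonneg_right hB'card (mul_nonneg (div_nonneg hM.le hm.le) (hQnn _ x y))
  have hid : c * (n : ℝ) ^ (-(d : ℝ) / α) = m / M * κ ^ 2 * ((15 * r₁) ^ (d : ℝ))⁻¹ := by
    have h1 : ((15 * r₁) ^ (d : ℝ))⁻¹ = (15 : ℝ) ^ (-(d : ℝ)) * A ^ (-(d : ℝ)) * (n : ℝ) ^ (-(d : ℝ) / α) := by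
      rw [← Real.rpow_neg (by positivity), Real.mul_rpow (by norm_num) hr₁0.le, hr₁,
        Real.mul_rpow hA0.le hnα.le, ← Real.rpow_mul hn0.le]
      have : 1 / α * -(d : ℝ) = -(d : ℝ) / α := by ring
      rw [this]; ring
    rw [h1, hc]; ring
  calc c * (n : ℝ) ^ (-(d : ℝ) / α) = m / M * κ ^ 2 * ((15 * r₁) ^ (d : ℝ))⁻¹ := hid
    _ ≤ m / M * ((15 * r₁) ^ (d : ℝ) * (M / m * Q (n + n) x y)) * ((15 * r₁) ^ (d : ℝ))⁻¹ := by
        gcongr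
    _ = Q (n + n) x y := by
        field_simp

end Literature.Probability.Process
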